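import Summits.RiemannHypothesis.RiemannHypothesis.Theorems.ThetaTier2RowSound
import HarnessLib

/-!
# THETA tier-2 kernel rows — twin primes `8969 ≤ q ≤ 9857` (module 12 of 13; cc-s2-1, WEIL typing lane; RH-FREE bookkeeping)

Data module of the tier-2 theta certificate (THETA-CERT-cc6 §E; HOME/cc-s2-1/gen22/TIER2-KERNEL-SPEC.md; soundness chain
`ThetaTier2Check … ThetaTier2RowSound`): the rows `(q, q⁺, m, δ·10¹², menu, k)` — `m = 5`, `δ = ⌊0.98·δ_q·10¹²⌋/10¹²` with
`δ_q = ½ log(q⁺/q)`, menu `0` = thin seed `(1/20, 19/20, 1)`, `η′ = 1/100` (menu `1` = `(1/4, 3/5, 1)`, `η′ = 1/20` for `q = 179, 191`),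
`t₀ = 2⁻¹⁵`; `K = 6`, `τ = 1/100`, `D = 3`, `W_l = 4`, `J = 64` — for the twin primes `8969 ≤ q ≤ 9857` in the range of the route item
`stmt-RiemannHypothesis-19172` (`WallsTenKTwin`, `route-RiemannHypothesis-WeilSemilocal`), checked in the kernel by `Row2.check`
(`decide +kernel`, ≈ 14 s per row), and the resulting REAL statements `T2Valid r.inp r.real ∧ r.RowFacts` (`Row2.check_sound`) that the
E-side assembly turns into `UC(q)`.  Nothing here bears on the truth of RH.
-/

set_option linter.dupNamespace false  -- the mandated namespace repeats `RiemannHypothesis`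

namespace Summit.RiemannHypothesis.RiemannHypothesis.Theorems.ThetaTier2

/-- Twin rows `8969 ≤ q ≤ 9419` (8 rows). [this cell, TIER2-KERNEL-SPEC §4] -/
def twinRows12_1 : List Row2 := [
  ⟨8969, 8971, 5, 109253066, 0, 15⟩, ⟨8999, 9001, 5, 108888889, 0, 15⟩, ⟨9011, 9013, 5, 108743897, 0, 15⟩, ⟨9041, 9043, 5, 108383101, 0, 15⟩,
  ⟨9239, 9241, 5, 106060606, 0, 15⟩, ⟨9281, 9283, 5, 105580694, 0, 15⟩, ⟨9341, 9343, 5, 104902590, 0, 15⟩, ⟨9419, 9421, 5, 104033970, 0, 15⟩ ]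

/-- The kernel verdict for `twinRows12_1`. [this cell, THETA-CERT-cc6 §E6] -/
theorem twinRows12_1_check : twinRows12_1.all Row2.check = true := by
  decide +kernel

/-- (K1)–(K7) and the row facts at every row of `twinRows12_1`. [this cell, THETA-CERT-cc6 §E6] -/
theorem twinRows12_1_valid : ∀ r ∈ twinRows12_1, T2Valid r.inp r.real ∧ r.RowFacts :=
  fun r hr => r.check_sound (List.all_eq_true.1 twinRows12_1_check r hr)

/-- Twin rows `9431 ≤ q ≤ 9857` (8 rows). [this cell, TIER2-KERNEL-SPEC §4] -/
def twinRows12_2 : List Row2 := [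
  ⟨9431, 9433, 5, 103901611, 0, 15⟩, ⟨9437, 9439, 5, 103835558, 0, 15⟩, ⟨9461, 9463, 5, 103572183, 0, 15⟩, ⟨9629, 9631, 5, 101765317, 0, 15⟩,
  ⟨9677, 9679, 5, 101260591, 0, 15⟩, ⟨9719, 9721, 5, 100823045, 0, 15⟩, ⟨9767, 9769, 5, 100327600, 0, 15⟩, ⟨9857, 9859, 5, 99411645, 0, 15⟩ ]

/-- The kernel verdict for `twinRows12_2`. [this cell, THETA-CERT-cc6 §E6] -/
theorem twinRows12_2_check : twinRows12_2.all Row2.check = true := by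
  decide +kernel

/-- (K1)–(K7) and the row facts at every row of `twinRows12_2`. [this cell, THETA-CERT-cc6 §E6] -/
theorem twinRows12_2_valid : ∀ r ∈ twinRows12_2, T2Valid r.inp r.real ∧ r.RowFacts :=
  fun r hr => r.check_sound (List.all_eq_true.1 twinRows12_2_check r hr)

end Summit.RiemannHypothesis.RiemannHypothesis.Theorems.ThetaTier2
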